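import Summits.RiemannHypothesis.RiemannHypothesis.Theorems.LiCoefficientsLiHeightLaw
import Summits.RiemannHypothesis.RiemannHypothesis.Theses.LiCoefficients
import HarnessLib

/-!
# RiemannHypothesis / LiCoefficients — item `LiWindowLowerBound` closed BY NAME (RH-FREE)

Route `RiemannHypothesis/LiCoefficients` (cell `pub/rh-li`, D-0059/D-0061).  The substance is the landed theorem `LiTheory.liWindowLowerBound_bound` (`LiCoefficientsLiHeightLaw.lean`; parts `LiCoefficientsLiWindow{Identity,Oscillatory,Turing}.lean`).
RH-FREE [rh-li-prover]; nothing here bears on the truth of RH.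
-/

noncomputable section

-- D-0017: `Summit.<S>.<S>.…` is the designed namespace of a single-problem summit.
set_option linter.dupNamespace false

namespace Summit.RiemannHypothesis.RiemannHypothesis.Theorems.LiTheory

/-- **Item `LiWindowLowerBound` of route `LiCoefficients` — PROVED** (the route decl by name). -/
theorem liWindowLowerBound_proof : Summit.RiemannHypothesis.RiemannHypothesis.Theses.LiCoefficients.LiWindowLowerBound :=
  liWindowLowerBound_bound

end Summit.RiemannHypothesis.RiemannHypothesis.Theorems.LiTheory

end
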